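import Mathlib
import Summits.ValiantsHypothesis.ValiantsHypothesis.Theorems.ValuativeGCTValuativeFlipFourRowWeightSupport
import Summits.ValiantsHypothesis.ValiantsHypothesis.Theorems.ValuativeGCTValuativeFlipFourRowSliceBound
import Summits.ValiantsHypothesis.ValiantsHypothesis.Theorems.ValuativeGCTValuativeFlipStabInvLeExplicit

/-!
# Det-side multiplicity bounds on four-row shapes

Wall-breaker axis k3 (det-orbit-closure multiplicity bounds) for crux `ValuativeGCT.ValuativeFlip`
(stmt-ValiantsHypothesis-12624), line `four-row-count`.  Weight support (`fourRowHwspLeRows`, file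
`…FourRowWeightSupport`: a `B`-semi-invariant of weight `λ*`, `ℓ(λ) ≤ 4`, only involves the last
four row slots) and the four-row slice bound (`stub_fourRowSliceBound`, file `…FourRowSliceBound`)
give `dim (Hom_{mδ} ⊓ SAND ⊓ HWSP(λ*)) ≤ (mδ + 1)^(2m² + m)` for every `λ ⊢ mδ` with `ℓ(λ) ≤ 4`
(`fourRowWeightBound`), and, in the crux's own currency, `dim T_U(λ) ≤ (mδ + 1)^(2m² + m)` for the
valuative truncation `T_U(λ)` of the route decl, uniformly in the centre `U` and the rank bound `r`
(`fourRowTruncBound`, via the landed `stub_stabInv_le_explicit`).  Elementary; no named facts.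
-/

set_option linter.dupNamespace false

namespace Summit.ValiantsHypothesis.ValiantsHypothesis.Theorems.ValuativeFlip

open MvPolynomial
open scoped BigOperators Matrix
open Literature.NumberTheory.DiophantineGeometry
open Literature.Computability.AlgebraicComplexity

noncomputable section

/-- **Det-side multiplicity bound on four-row shapes** (wall-breaker axis k3 of crux
`ValuativeGCT.ValuativeFlip`, line `four-row-count`).  For `m ≥ 2`, every `δ` and every partition
`λ ⊢ mδ` with at most four parts, the degree-`mδ` row-wise unimodular sandwich invariants on
`End(ℂ^{m×m})` that are `B`-semi-invariant of weight `λ*` span a space of dimension at most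
`(mδ + 1)^(2m² + m)`: they only involve the last four row slots (`fourRowHwspLeRows`), where the
four-row slice bound `stub_fourRowSliceBound` applies.  (The crux's truncation `T_U(λ)` is contained
in this space for `U = ⊥`, by the landed `stub_stabInv_le_explicit`.) [folklore; BLMW 2011 §5.2] -/
theorem fourRowWeightBound : ∀ (m : ℕ), 2 ≤ m → ∀ (δ : ℕ) (lam : Nat.Partition (m * δ)), lam.parts.card ≤ 4 → Module.finrank ℂ ↥(MvPolynomial.homogeneousSubmodule (MatIdx m × MatIdx m) ℂ (m * δ) ⊓ (⨅ (P : Matrix (Fin m) (Fin m) ℂ) (Q : Matrix (Fin m) (Fin m) ℂ) (_ : P.det = 1) (_ : Q.det = 1), LinearMap.ker ((MvPolynomial.aeval fun p : MatIdx m × MatIdx m => ∑ l : MatIdx m, (P (ofLex p.2).1 (ofLex l).1 * Q (ofLex l).2 (ofLex p.2).2) • (MvPolynomial.X (p.1, l) : MvPolynomial (MatIdx m × MatIdx m) ℂ)).toLinearMap - (LinearMap.id : MvPolynomial (MatIdx m × MatIdx m) ℂ →ₗ[ℂ] MvPolynomial (MatIdx m × MatIdx m) ℂ))) ⊓ (⨅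 (g : Matrix.GeneralLinearGroup (MatIdx m) ℂ) (_ : IsUpperTriangular g), LinearMap.ker ((MvPolynomial.aeval fun p : MatIdx m × MatIdx m => ∑ l : MatIdx m, ((g⁻¹ : Matrix.GeneralLinearGroup (MatIdx m) ℂ) : Matrix (MatIdx m) (MatIdx m) ℂ) p.1 l • (MvPolynomial.X (l, p.2) : MvPolynomial (MatIdx m × MatIdx m) ℂ)).toLinearMap - weightChar ((Weight.dualOfPartition (m * m) lam).toMatIdx : Weight (MatIdx m)) g • (LinearMap.id : MvPolynomial (MatIdx m × MatIdx m) ℂ →ₗ[ℂ] MvPolynomial (MatIdx m × MatIdx m) ℂ)))) ≤ (m * δ + 1) ^ (2 * m ^ 2 + m) := by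
  intro m hm δ lam hlam
  haveI : Module.Finite ℂ ↥(MvPolynomial.homogeneousSubmodule (MatIdx m × MatIdx m) ℂ (m * δ)) :=
    Module.Finite.iff_fg.mpr (MvPolynomial.homogeneousSubmodule_fg (MatIdx m × MatIdx m) ℂ (m * δ))
  haveI : Module.Finite ℂ ↥(MvPolynomial.homogeneousSubmodule (MatIdx m × MatIdx m) ℂ (m * δ) ⊓
      (⨅ (P : Matrix (Fin m) (Fin m) ℂ) (Q : Matrix (Fin m) (Fin m) ℂ) (_ : P.det = 1) (_ : Q.det = 1), LinearMap.ker ((MvPolynomial.aeval fun p : MatIdx m × MatIdx m => ∑ l : MatIdx m, (P (ofLex p.2).1 (ofLex l).1 * Q (ofLex l).2 (ofLex p.2).2) • (MvPolynomial.X (p.1, l) : MvPolynomial (MatIdx m × MatIdx m) ℂ)).toLinearMap - (LinearMap.id : MvPolynomial (MatIdx m × MatIdx m) ℂ →ₗ[ℂ] MvPolynomial (MatIdx m × MatIdx m) ℂ))) ⊓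
      Subalgebra.toSubmodule (MvPolynomial.supported ℂ {p : MatIdx m × MatIdx m | m * m ≤ (((matIdxEquiv m).symm p.1 : Fin (m * m)) : ℕ) + 4})) :=
    Submodule.finiteDimensional_of_le (inf_le_left.trans inf_le_left)
  exact (Submodule.finrank_mono (inf_le_inf le_rfl (fourRowHwspLeRows m (m * δ) lam hlam))).trans
    (stub_fourRowSliceBound m hm (m * δ))

/-- **Det-side bound on the valuative truncation over four-row shapes, in the crux's currency.**
For `m ≥ 2`, every centre `U`, rank bound `r`, degree `δ` and partition `λ ⊢ mδ` with at most four
parts, the valuative truncation `T_U(λ)` of the route decl `ValuativeGCT.ValuativeFlip` (verbatim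
`let χ`, `let T`) has `dim T_U(λ) ≤ (mδ + 1)^(2m² + m)`, uniformly in `U` and `r`: drop the vanishing-
order clause, pass from `Stab_End(det_m)`-invariance to sandwich invariance (`stub_stabInv_le_explicit`)
and apply `fourRowWeightBound`.  So on four-row shapes a valuative flip at `(n, m)` needs
`mult_{λ*} ℂ[Δ_m(X₀₀^{m-n} per_n)] > (mδ+1)^(2m²+m)` at most — and the line's per-side floor
`C(δ + 2m² + m + 1, δ)` eventually exceeds this (growth gap B5). [folklore; this crux's B5/B6] -/
theorem fourRowTruncBound : ∀ (m : ℕ), 2 ≤ m → ∀ (U : Submodule ℂ (MatIdx m → ℂ)) (r δ : ℕ) (lam : Nat.Partition (m * δ)), lam.parts.card ≤ 4 → (let χ : Weight (MatIdx m) := (Weight.dualOfPartition (m * m) lam).toMatIdx; let T : Submodule ℂ (MvPolynomial (MatIdx m × MatIdx m) ℂ) := MvPolynomial.homogeneousSubmodule (MatIdx m × MatIdx m) ℂ (m * δ) ⊓ ((MvPolynomial.vanishingIdeal ℂ {p : MatIdx m × MatIdx m → ℂ | ∀ j : MatIdx m, (fun i => p (j, i)) ∈ U}) ^ (δ * (m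 - r))).restrictScalars ℂ ⊓ (⨅ (M : Matrix (MatIdx m) (MatIdx m) ℂ) (_ : linSubst (MatIdx m) ℂ M (detFormLex ℂ m) = detFormLex ℂ m), LinearMap.ker ((MvPolynomial.aeval (R := ℂ) fun p : MatIdx m × MatIdx m => ∑ l : MatIdx m, M l p.2 • MvPolynomial.X (p.1, l)).toLinearMap - LinearMap.id (R := ℂ) (M := MvPolynomial (MatIdx m × MatIdx m) ℂ))) ⊓ (⨅ (g : Matrix.GeneralLinearGroup (MatIdx m) ℂ) (_ : IsUpperTriangular g), LinearMap.ker ((MvPolynomial.aeval (R := ℂ) fun p : MatIdx m × MatIdx m => ∑ l : MatIdx m, ((g⁻¹ : Matrix.GeneralLinearGroup (MatIdx m) ℂ) : Matrix (MatIdx m) (MatIdx m) ℂ) p.1 l • MvPolynomial.X (l, p.2)).toLinearMap - weightChar χ g • LinearMap.id (R := ℂ) (M := MvPolynomial (MatIdx m × MatIdx m) ℂ))); Module.finrank ℂ ↥T ≤ (m * δ + 1) ^ (2 * m ^ 2 + m)) := by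
  intro m hm U r δ lam hlam χ T
  haveI : Module.Finite ℂ ↥(MvPolynomial.homogeneousSubmodule (MatIdx m × MatIdx m) ℂ (m * δ)) :=
    Module.Finite.iff_fg.mpr (MvPolynomial.homogeneousSubmodule_fg (MatIdx m × MatIdx m) ℂ (m * δ))
  haveI : Module.Finite ℂ ↥(MvPolynomial.homogeneousSubmodule (MatIdx m × MatIdx m) ℂ (m * δ) ⊓
      (⨅ (P : Matrix (Fin m) (Fin m) ℂ) (Q : Matrix (Fin m) (Fin m) ℂ) (_ : P.det = 1) (_ : Q.det = 1), LinearMap.ker ((MvPolynomial.aeval fun p : MatIdx m × MatIdx m => ∑ l : MatIdx m, (P (ofLex p.2).1 (ofLex l).1 * Q (ofLex l).2 (ofLex p.2).2) • (MvPolynomial.X (p.1, l) : MvPolynomial (MatIdx m × MatIdx m) ℂ)).toLinearMap - (LinearMap.id : MvPolynomial (MatIdx m × MatIdx m) ℂ →ₗ[ℂ] MvPolynomial (MatIdx m × MatIdx m) ℂ))) ⊓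
      (⨅ (g : Matrix.GeneralLinearGroup (MatIdx m) ℂ) (_ : IsUpperTriangular g), LinearMap.ker ((MvPolynomial.aeval fun p : MatIdx m × MatIdx m => ∑ l : MatIdx m, ((g⁻¹ : Matrix.GeneralLinearGroup (MatIdx m) ℂ) : Matrix (MatIdx m) (MatIdx m) ℂ) p.1 l • (MvPolynomial.X (l, p.2) : MvPolynomial (MatIdx m × MatIdx m) ℂ)).toLinearMap - weightChar ((Weight.dualOfPartition (m * m) lam).toMatIdx : Weight (MatIdx m)) g • (LinearMap.id : MvPolynomial (MatIdx m × MatIdx m) ℂ →ₗ[ℂ] MvPolynomial (MatIdx m × MatIdx m) ℂ)))) :=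
    Submodule.finiteDimensional_of_le (inf_le_left.trans inf_le_left)
  exact (Submodule.finrank_mono (le_inf (le_inf (inf_le_left.trans (inf_le_left.trans inf_le_left))
    ((inf_le_left.trans inf_le_right).trans ((stub_stabInv_le_explicit m).trans inf_le_left)))
    inf_le_right)).trans (fourRowWeightBound m hm δ lam hlam)

end

end Summit.ValiantsHypothesis.ValiantsHypothesis.Theorems.ValuativeFlip
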